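import Literature.IUT.LogThetaLattice.LogStripOfKits
import Literature.IUT.LogThetaLattice.LatticeDiagramBridge
import Literature.IUT.LogThetaLattice.StripFrameThetaLinks

/-!
# `ThetaLinkData.ofKits` and the log-theta-lattice over the assembled frame ([IUTchII] Cor 4.10; [IUTchIII] Def 1.4, Thm 1.5 (i)(ii))

Mochizuki, *Inter-universal Teichmüller Theory II*, kurims manuscript (Dec 2020), Cor 4.10 (i)–(iv) pp. 158–160;
*III* (May 2020), Def 1.4 pp. 45–46, Thm 1.5 (i)(ii) p. 48, Def 3.8 (iii) p. 113.
([IUTchIII] Def 1.4 p.45) [claim: Mochizuki2012, status: disputed]. MERGE BRIDGE (plan/L6/MERGE-MAP.md row 46 / B10 part 2, sequel;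
C312-RESIDUALS §1a′ binder `lat`), consumer seat abc-iut-L6-t3. Nothing of the series is asserted.

The §1 interface `ThetaLinkData S` (this seat, `HodgeTheaterLogLink.lean`) records what [IUTchIII] §1 uses of
[IUTchII] Cor 4.10: the `F^{⊩▶×μ}`-prime-strips `†F^{⊩▶×μ}_△`, `†F^{⊩▶×μ}_{env}`, `†F^{⊩▶×μ}_{gau}` attached FUNCTORIALLY to a
Hodge theater (Cor 4.10 (i)(ii)), the natural isomorphisms of the associated `F^{⊢×μ}`-prime-strips and "coincides
with the full poly-isomorphism" (Cor 4.10 (iv)). Over the assembled frame `StripFrame.ofKits` (abc-iut-L5-t4's kits,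
`StripFrameOfKits.lean`) this file reduces it to the honest kit-level input and draws the consequence for the
Cor 3.12 crew:

* `ThetaLinkKit X` — the three pilot-strip functors `HTRep FK ⥤ X.Fglxm` on the representative-level groupoid of
  `Θ^{±ell}`-Hodge theaters with the Cor 4.10 (iv) data (owner of the instances: abc-iut-L6-t2 / L6-t6, whose
  `HodgeTheaterStrips.delta/env/gau` (ThetaGauLinks) and `FVdashTriMuPrimeStripF` are the objects; TODO-merge);
* `ThetaLinkData.ofKits` — the §1 interface INSTANTIATED over `StripFrame.ofKits` (the Cor 4.10 (iv) clause
  transferred along `AsSmall` by the pointwise surjectivity transfer and abc-iut-L6-t2's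
  `mapIso_surjective_iff_map_full`);
* `LogThetaLatticeDiagram.ofKits` — Def 1.4: ANY family of distinct `Θ^{±ell}`-Hodge theaters over the kits indexed by
  `ℤ × ℤ` is a log-theta-lattice over the assembled frame (the arrows are full poly-isomorphisms, no further data);
  hence Thm 1.5 (i)/(ii) (`vertical_inducedDHT_full`, `horizontal_inducedFxm_full`) hold for it and
  `LogThetaLatticeDiagram.toLGPSkeleton` (this seat's `LatticeDiagramBridge`) yields abc-iut-L6-t4's Def 3.8 (iii)
  lattice skeleton — the `lat` binder of `Summit.ABC.IUTFork.Cor312.Setting.ofComparison` (C312-RESIDUALS §1a′) —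
  from kit-level data.
-/

namespace Literature.IUT.LogThetaLattice

open CategoryTheory
open Literature.IUT.HodgeTheaters Literature.IUT.HodgeTheaters.PMBaseKit
open AsSmallTransport

universe u

variable {l : ℕ} {K : PMBaseKit.{u} l} {M : K.MultKit} {FK : K.FKit M} {L : FK.MonoLaws}

/-- **IUTchII:Cor4.10(i)** (kurims p.158) INPUT: the `F^{⊩▶×μ}`-prime-strips `†F^{⊩▶×μ}_△` [Cor 4.10 (i)], `†F^{⊩▶×μ}_{env}` /
`†F^{⊩▶×μ}_{gau}` [Cor 4.10 (ii)] of a `Θ^{±ell}`-Hodge theater over abc-iut-L5-t4's kits, FUNCTORIALLY in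
representative-level isomorphisms (`HTRep FK`), valued in the `F^{⊩▶×μ}`-prime-strip category of a `TimesMuSide`,
with Cor 4.10 (iv): the natural isomorphisms `†F^{⊢×μ}_△ ⥲ †F^{⊢×μ}_{env/gau}` of associated `F^{⊢×μ}`-prime-strips and
"coincides with the full poly-isomorphism" (for every pair of theaters). TODO-merge: abc-iut-L6-t2 / L6-t6
([IUTchII] §4: `HodgeTheaterStrips`, `FVdashTriMuPrimeStripF`). ([IUTchII] Cor 4.10 (i) p.158) [claim: Mochizuki2012, status: disputed] -/
structure ThetaLinkKit (X : TimesMuSide FK L) : Type (max 1 u) where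
  /-- `†HT ↦ †F^{⊩▶×μ}_△` [IUTchII, Cor 4.10 (i)] -/
  pilotDelta : HTRep FK ⥤ X.Fglxm
  /-- `†HT ↦ †F^{⊩▶×μ}_{env}` (`nonGaussian`) resp. `†F^{⊩▶×μ}_{gau}` (`gaussian`) [IUTchII, Cor 4.10 (ii)] -/
  pilotTheta : LatticeKind → (HTRep FK ⥤ X.Fglxm)
  /-- [IUTchII, Cor 4.10 (iv)] the natural isomorphisms `†F^{⊢×μ}_△ ⥲ †F^{⊢×μ}_{env}`, `⥲ †F^{⊢×μ}_{gau}` -/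
  unitPortion : ∀ k : LatticeKind,
    pilotDelta ⋙ (X.FglxmToFvtxm ⋙ X.FvtxmToFxm) ≅ pilotTheta k ⋙ (X.FglxmToFvtxm ⋙ X.FvtxmToFxm)
  /-- [IUTchII, Cor 4.10 (iv)] "… coincides with the full poly-isomorphism" -/
  induced_full : ∀ (k : LatticeKind) (H H' : HTRep FK),
    (PolyIso.full ((pilotTheta k).obj H) (pilotDelta.obj H')).map (X.FglxmToFvtxm ⋙ X.FvtxmToFxm) = PolyIso.full _ _

section

variable (L) (hbij : FK.IsomFtoDBijective) (hsurj : FK.IsomFmtoDmSurjective) (hR : FK.RlfOfIsStrip)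
  (X : TimesMuSide FK L) (TK : ThetaLinkKit X)

/-- **IUTchII:Cor4.10(iii)** (kurims p.160) **`ThetaLinkData.ofKits`**: the §1 horizontal-arrow interface ([IUTchII] Cor 4.10 (i)–(iv))
INSTANTIATED over the assembled frame `StripFrame.ofKits` from a `ThetaLinkKit`; the `Θ^{×μ}`- / `Θ^{×μ}_{gau}`-links
(`ThetaLinkData.link` = full poly-isomorphisms, Cor 4.10 (iii)) and Thm 1.5 (ii) (`linkInducedFxm_full`) are then
available over abc-iut-L5-t4's kits. ([IUTchII] Cor 4.10 (iii) p.160) [claim: Mochizuki2012, status: disputed] -/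
noncomputable def ThetaLinkData.ofKits : ThetaLinkData (StripFrame.ofKits L hbij hsurj hR X) where
  pilotDelta := liftF TK.pilotDelta
  pilotTheta k := liftF (TK.pilotTheta k)
  unitPortion k :=
    NatIso.ofComponents (fun H => AsSmall.up.mapIso ((TK.unitPortion k).app (ULift.down H)))
      (fun f => ULift.ext _ _ ((TK.unitPortion k).hom.naturality f.down))
  induced_full k H H' := by
    change (PolyIso.full ((liftF (TK.pilotTheta k)).obj H) ((liftF TK.pilotDelta).obj H')).map
        (liftF (X.FglxmToFvtxm ⋙ X.FvtxmToFxm)) = PolyIso.full _ _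
    rw [← Literature.IUT.HodgeArakelov.mapIso_surjective_iff_map_full]
    refine liftF_mapIso_surjective_at _ _ _ ?_
    exact (Literature.IUT.HodgeArakelov.mapIso_surjective_iff_map_full _ _ _).mpr
      (TK.induced_full k (ULift.down H) (ULift.down H'))

/-- **IUTchIII:Def1.4** (kurims p.45) **Def 1.4 over the kits**: any family of DISTINCT `Θ^{±ell}`-Hodge theaters over abc-iut-L5-t4's kits
indexed by `ℤ × ℤ` is a log-theta-lattice (of the given kind) over the assembled frame — the vertical arrows being
the full log-links and the horizontal ones the full poly-isomorphisms of Cor 4.10 (iii), no further data is needed.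
([IUTchIII] Def 1.4 p.45) [claim: Mochizuki2012, status: disputed] -/
noncomputable def LogThetaLatticeDiagram.ofKits (LK : LogKit FK) (kind : LatticeKind) (H : ℤ × ℤ → FK.ThetaPMEllHT)
    (hH : Function.Injective H) :
    LogThetaLatticeDiagram (LogStripData.ofKits L hbij hsurj hR X LK) (ThetaLinkData.ofKits L hbij hsurj hR X TK) where
  kind := kind
  HT p := AsSmall.up.obj (HTRep.of (H p))
  injective _ _ h := hH (congrArg (fun Y : AsSmall.{max 1 u} (HTRep FK) => HTRep.out (ULift.down Y)) h)

/-- **IUTchIII:Thm1.5(i)** (kurims p.48) Thm 1.5 (i) OVER THE KITS (vertical coricity): the vertical arrows of such a lattice induce the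
FULL poly-isomorphisms of associated `𝒟`-Hodge theaters (representative-level `DHTRep`).
([IUTchIII] Thm 1.5 (i) p.48) [claim: Mochizuki2012, status: disputed] -/
theorem vertical_inducedDHT_full_ofKits (LK : LogKit FK) (kind : LatticeKind) (H : ℤ × ℤ → FK.ThetaPMEllHT)
    (hH : Function.Injective H) (n m : ℤ) :
    ((LogThetaLatticeDiagram.ofKits L hbij hsurj hR X TK LK kind H hH).vertical n m).inducedDHT = PolyIso.full _ _ :=
  rfl

/-- **IUTchIII:Thm1.5(ii)** (kurims p.48) Thm 1.5 (ii) OVER THE KITS (horizontal coricity): the horizontal arrows induce the FULL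
poly-isomorphisms of associated `F^{⊢×μ}`-prime-strips — resting on the Cor 4.10 (iv) clause `induced_full` of the
`ThetaLinkKit` transferred along `AsSmall`. ([IUTchIII] Thm 1.5 (ii) p.48) [claim: Mochizuki2012, status: disputed] -/
theorem horizontal_inducedFxm_full_ofKits (LK : LogKit FK) (kind : LatticeKind) (H : ℤ × ℤ → FK.ThetaPMEllHT)
    (hH : Function.Injective H) (n m : ℤ) :
    (ThetaLinkData.ofKits L hbij hsurj hR X TK).linkInducedFxm kind
        ((LogThetaLatticeDiagram.ofKits L hbij hsurj hR X TK LK kind H hH).HT (n, m))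
        ((LogThetaLatticeDiagram.ofKits L hbij hsurj hR X TK LK kind H hH).HT (n + 1, m)) = PolyIso.full _ _ :=
  (LogThetaLatticeDiagram.ofKits L hbij hsurj hR X TK LK kind H hH).horizontal_inducedFxm_full n m

/-- **IUTchIII:Def3.8(iii)** (kurims p.113) For the Cor 3.12 crew: abc-iut-L6-t4's Def 3.8 (iii) lattice SKELETON (`LGPGaussianLogThetaLattice`,
the `lat` binder of `Summit.ABC.IUTFork.Cor312.Setting.ofComparison`, C312-RESIDUALS §1a′) obtained from KIT-LEVEL data:
a family of distinct `Θ^{±ell}`-Hodge theaters over abc-iut-L5-t4's kits, through this seat's `LatticeDiagramBridge`.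
([IUTchIII] Def 3.8 (iii) p.113) [claim: Mochizuki2012, status: disputed] -/
noncomputable def lgpSkeletonOfKits (LK : LogKit FK) (kind : LatticeKind) (H : ℤ × ℤ → FK.ThetaPMEllHT)
    (hH : Function.Injective H) :=
  (LogThetaLatticeDiagram.ofKits L hbij hsurj hR X TK LK kind H hH).toLGPSkeleton

/-- **IUTchIII:Def3.8(iii)** (kurims p.113) The skeleton's theaters are the given Hodge theaters (as objects of the assembled frame).
([IUTchIII] Def 3.8 (iii) p.113) [claim: Mochizuki2012, status: disputed] -/
theorem lgpSkeletonOfKits_theater (LK : LogKit FK) (kind : LatticeKind) (H : ℤ × ℤ → FK.ThetaPMEllHT)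
    (hH : Function.Injective H) (n m : ℤ) :
    (lgpSkeletonOfKits L hbij hsurj hR X TK LK kind H hH).theater n m = AsSmall.up.obj (HTRep.of (H (n, m))) :=
  rfl

end

end Literature.IUT.LogThetaLattice
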